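import Mathlib
import Summits.KontsevichZagierPeriods.Zeta5Search.ProfileA6p23CellsA
import Summits.KontsevichZagierPeriods.Zeta5Search.ProfileA6p23CellsB
import Summits.KontsevichZagierPeriods.Zeta5Search.ProfileA6p172635CellsA
import Summits.KontsevichZagierPeriods.Zeta5Search.ProfileA6p172635CellsB
import Summits.KontsevichZagierPeriods.Zeta5Search.ProfileA6p1635CellsA
import Summits.KontsevichZagierPeriods.Zeta5Search.ProfileA6p1635CellsB
import Summits.KontsevichZagierPeriods.Zeta5Search.DenomLaw.Profile15aPath
import Summits.KontsevichZagierPeriods.Zeta5Search.DenomLaw.PathWeightProfile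
import Summits.KontsevichZagierPeriods.Zeta5Search.DenomLaw.VGainPalCoverKit
import Summits.KontsevichZagierPeriods.Zeta5Search.DenomLaw.Profile11PathA
import Summits.KontsevichZagierPeriods.Zeta5Search.DenomLaw.LawA3KCoverKit
import Summits.KontsevichZagierPeriods.Zeta5Search.DenomLaw.LawA4CoverKit
import Summits.KontsevichZagierPeriods.Zeta5Search.DenomLaw.Profile12PathC
import Summits.KontsevichZagierPeriods.Zeta5Search.DenomLaw.Profile13PathA
import Summits.KontsevichZagierPeriods.Zeta5Search.DenomLaw.Profile15aPath
import Summits.KontsevichZagierPeriods.Zeta5Search.DenomLaw.ProfileA6PathI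
import HarnessLib

/-!
# ζ(5) search — a < 7 PROFILES `A6P23`, `A6P172635`, `A6P1635` for EVERY sorted parameter vector at depth `d < 2p` (DENOM-LAW D1, prover-d1 gen 24; generated by gen 23's `gen_pathGEN.py` + gen 24's LB♯ / J laws)

Cell `pub-zeta5` (HONEST FRAMING: systematic search; no irrationality claim unless certified), TRACK «DENOM-LAW» D1 prover seat (denom-prover-d1
gen 23, `HOME/denom-law/prover-d1/ATTEMPT-23.md`; path generator `g23/gen/path23/gen_pathGEN.py`, cover specs `g23/gen/specs/`).  The a = 6 stratum
(`b₇ < p ≤ b₆`: 9,264 / 13,757 first-period instances at p = 7 / 11) after `ProfileA6TopPath` / `ProfileA6u47Path`: the profiles `A6P23`, `A6P172635`, `A6P1635` (long pair blocks =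
the up-sets generated by the pairs named in each section; 28 + 22 + 19 instances at p = 7), each with ONE law at every depth read off its machine-generated covers
(`decide` on the whole type lists, covers complete for every `p`): `A6P23`: THEOREM A⁗ `cover_A4` at M = 8; `A6P172635`: the V-gain with palindromic rows `vgainPal_of_cover` (`N = 6`, `R = -1`); `A6P1635`: the V-gain with palindromic rows `vgainPal_of_cover` (`N = 6`, `R = -2`).  The node `⌊d/p⌋ − N_p − min([⌊d/p⌋ ≥ 2], 5 − C⋆)` is met at `⌊d/p⌋ ≤ 1`
(`C⋆` by new finite checks with six long parameters); the theorems carry `d < 2p` (the depth `⌊d/p⌋ = 2` of these profiles is left open).  p-UNIFORM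
hypotheses (lead l.9565): stratum + ORDER conditions + depth only.  Results: `pathAccounting_profile<X>` (every `j`) and
`pathAccountingFirstPeriod_profile<X>`.  MODEL/structure-side valuation bookkeeping of the cell's own rationals; nothing about ζ(5); no γ; records
in print UNMOVED.
-/

open Finset

namespace Summit.KontsevichZagierPeriods.Zeta5Search.FullProfile

open Summit.KontsevichZagierPeriods.Zeta5Search.ClusterValuation
open Summit.KontsevichZagierPeriods.Zeta5Search.CasoratianValuation (InPolytope shift casoratian pairFloors refund)
open Summit.KontsevichZagierPeriods.Zeta5Search.WedgeDictionary (dOf)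
open Summit.KontsevichZagierPeriods.Zeta5Search.ClassTypeCover
open Summit.KontsevichZagierPeriods.Zeta5Search.DenomLaw (cStar FirstPeriod Sorted7 vgain_of_cover vgainPal_of_cover cover_A3K cover_A4)
open Summit.KontsevichZagierPeriods.Zeta5Search.DenomLaw.FirstPeriodKit (sorted7_chain firstPeriod_pair pairFloors_expand)
open Summit.KontsevichZagierPeriods.Zeta5Search.SortedProfile
/-! ## The a = 6 profile `A6P23`: long pair blocks generated by [(2, 3)] (maximal short [(1, 7)]); `N_p = 15`, `C⋆ ≤ 10` -/

section A6P23

variable {b : ℕ → ℤ} {j p : ℕ}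

/-- **`C⋆ ≤ 10` on `A6P23`** (6 long parameters `b_7 < p ≤ b_6`; every pair block below one of the short pairs [(1, 7)] is short): the finite check over
the 5,040 orderings (`decide +kernel`). -/
theorem cStar_le_ten_A6P23 {b : ℕ → ℤ} {p : ℕ} (hs : Sorted7 b) (hA : b 7 < (p : ℤ)) (hS17 : b 0 < (p : ℤ) + b 1 + b 7) : cStar b p ≤ 10 := by
  obtain ⟨h21, h32, h43, h54, h65, h76⟩ := sorted7_chain hs
  refine DenomLaw.FirstPeriodKit.cStar_le_of_profile (fun i => i.val + 1 ≤ 6)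
    (fun i k => ¬ (((i.val + 1 ≤ 1 ∧ k.val + 1 ≤ 7) ∨ (k.val + 1 ≤ 1 ∧ i.val + 1 ≤ 7)) ∧ i.val ≠ k.val)) 10 ?_ ?_ (by decide +kernel)
  · intro i h
    have := i.isLt
    by_contra hc
    interval_cases hv : i.val <;> simp only [Nat.reduceAdd] at h hc <;> omega
  · intro i k hik h
    obtain ⟨hsh, hne⟩ := h
    have := i.isLt; have := k.isLt
    exfalso
    rcases hsh with ⟨h1, h2⟩ | ⟨h1, h2⟩ <;> interval_cases hv : i.val <;> interval_cases hw : k.val <;> simp only [Nat.reduceAdd] at hik h1 h2 <;> omega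

/-- **THEOREM A⁗ on `A6P23`, general `b`, every depth**: `v_p(Cas_j(b)) ≥ -9 = 7 − 2M` in the frame `(8, [1, -5, -5, 1])` (gen 18's `DenomLaw.cover_A4`; its five
clauses `decide`d on both covers). -/
theorem cas_geA6P23 (hb : InPolytope b) (hs : Sorted7 b) (hbj : InPolytope (shift b j)) (hj1 : 1 ≤ j) (hj7 : j ≤ 7)
    (hprime : p.Prime) (hp5 : 5 ≤ p) (hwin : (b 0 + 2 : ℤ) < (p : ℤ) ^ 2) (hA : b 7 < (p : ℤ)) (hA6 : (p : ℤ) ≤ b 6) (hL23 : (p : ℤ) + b 2 + b 3 ≤ b 0) (hS17 : b 0 < (p : ℤ) + b 1 + b 7)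
    (hF1 : b 1 < 2 * (p : ℤ)) (hF2 : b 0 < 2 * (p : ℤ) + b 6 + b 7) (hcas : casoratian b j ≠ 0) :
    -9 + (if (p : ℤ) ≤ dOf b then (0 : ℤ) else 0) ≤ padicValRat p (casoratian b j) := by
  haveI : Fact p.Prime := ⟨hprime⟩
  have hp2 : p % 2 = 1 := Nat.odd_iff.1 (hprime.odd_of_ne_two (by omega))
  obtain ⟨h21, h32, h43, h54, h65, h76⟩ := sorted7_chain hs
  obtain ⟨h0, hb1, hb2, hb3, hb4, hb5, hb6, hb7, hc1⟩ := box hb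
  have hpb : (p : ℤ) ≤ b 0 := by linarith
  have hT : ([1, -5, -5, 1] : List ℤ).reverse = [1, -5, -5, 1] := by decide
  rw [ite_self, add_zero]
  rcases Int.emod_two_eq_zero_or_one (b 0) with hr | hr
  · exact cover_A4 hb hbj hj1 hj7 hprime hp5 hpb hwin (coverA6P23_ev hb hs hA hA6 hL23 hS17 hF1 hF2 hp5 hp2 hr) (M := 8) (by norm_num) (by decide) hT
      (by rw [oddFlag_false hr]; decide) (by norm_num) hcas
  · exact cover_A4 hb hbj hj1 hj7 hprime hp5 hpb hwin (coverA6P23_od hb hs hA hA6 hL23 hS17 hF1 hF2 hp5 hp2 hr) (M := 8) (by norm_num) (by decide) hT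
      (by rw [oddFlag_true hr]; decide) (by norm_num) hcas

/-- **`PathAccountingFirstPeriod`'s conclusion on `A6P23`, EVERY sorted `b`, every direction `j`, depth `d < 2p`** (`N_p = 15`, `C⋆ ≤ 10`; node `-10` at
`⌊d/p⌋ = 0`, `-9` at `⌊d/p⌋ = 1`). -/
theorem pathAccounting_profileA6P23 (b : ℕ → ℤ) (j p : ℕ) (hb : InPolytope b) (hs : Sorted7 b) (hbj : InPolytope (shift b j))
    (hj1 : 1 ≤ j) (hj7 : j ≤ 7) (hprime : p.Prime) (hp5 : 5 ≤ p) (hwin : (b 0 + 2 : ℤ) < (p : ℤ) ^ 2) (hfp : FirstPeriod b p)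
    (hA : b 7 < (p : ℤ)) (hA6 : (p : ℤ) ≤ b 6) (hL23 : (p : ℤ) + b 2 + b 3 ≤ b 0) (hS17 : b 0 < (p : ℤ) + b 1 + b 7) (hd2 : dOf b < 2 * (p : ℤ))
    (hcas : casoratian b j ≠ 0) :
    dOf b / (p : ℤ) - pairFloors b p - min (if 2 ≤ dOf b / (p : ℤ) then (1 : ℤ) else 0) (5 - (cStar b p : ℤ))
      ≤ padicValRat p (casoratian b j) := by
  obtain ⟨hF1, hF2⟩ := fp_bounds hfp
  have hp0 : (0 : ℤ) < p := by exact_mod_cast hprime.pos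
  have hpf : pairFloors b p = 15 := by
    obtain ⟨h21, h32, h43, h54, h65, h76⟩ := sorted7_chain hs
    exact pairFloors_eq_15a hb hs hprime.pos hS17 hL23 hfp
  rw [hpf]
  have hC : (cStar b p : ℤ) ≤ 10 := by exact_mod_cast cStar_le_ten_A6P23 hs hA hS17
  have hfd : dOf b / (p : ℤ) < 2 := by rw [Int.ediv_lt_iff_lt_mul hp0]; linarith
  rw [if_neg (by omega)]
  have hmin : -5 ≤ min (0 : ℤ) (5 - (cStar b p : ℤ)) := le_min (by norm_num) (by linarith)
  have hlaw := cas_geA6P23 hb hs hbj hj1 hj7 hprime hp5 hwin hA hA6 hL23 hS17 hF1 hF2 hcas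
  by_cases h1 : (p : ℤ) ≤ dOf b
  · have hfd1 : dOf b / (p : ℤ) ≤ 1 := by omega
    rw [if_pos h1] at hlaw
    linarith
  · rw [if_neg h1] at hlaw
    push Not at h1
    have hd0 : 0 ≤ dOf b := by have := hb.2.2; unfold dOf; linarith
    have hfd0 : dOf b / (p : ℤ) = 0 := Int.ediv_eq_zero_of_lt hd0 h1
    rw [hfd0]
    linarith

/-- **THE NODE ON `A6P23` AT DEPTH `d < 2p`, EVERY SORTED `b`: `PathAccountingFirstPeriod` with its binders VERBATIM plus `b_7 < p ≤ b_6`, the profile's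
ORDER conditions and `d < 2p`.** -/
theorem pathAccountingFirstPeriod_profileA6P23 :
    ∀ (b : ℕ → ℤ) (p : ℕ), InPolytope b → Sorted7 b → InPolytope (shift b 7) →
      p.Prime → 5 ≤ p → (b 0 + 2 : ℤ) < (p : ℤ) ^ 2 → FirstPeriod b p →
      b 7 < (p : ℤ) → (p : ℤ) ≤ b 6 → (p : ℤ) + b 2 + b 3 ≤ b 0 → b 0 < (p : ℤ) + b 1 + b 7 → dOf b < 2 * (p : ℤ) → casoratian b 7 ≠ 0 →
        dOf b / (p : ℤ) - pairFloors b p - min (if 2 ≤ dOf b / (p : ℤ) then (1 : ℤ) else 0) (5 - (cStar b p : ℤ))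
          ≤ padicValRat p (casoratian b 7) :=
  fun b p hb hs hb7 hprime hp5 hwin hfp hA hA6 hL23 hS17 hd2 hcas =>
    pathAccounting_profileA6P23 b 7 p hb hs hb7 (by norm_num) (by norm_num) hprime hp5 hwin hfp hA hA6 hL23 hS17 hd2 hcas

end A6P23

/-! ## The a = 6 profile `A6P172635`: long pair blocks generated by [(1, 7), (2, 6), (3, 5)] (maximal short [(1, 6), (2, 5), (3, 4)]); `N_p = 12`, `C⋆ ≤ 10` -/

section A6P172635

variable {b : ℕ → ℤ} {j p : ℕ}

/-- **The V-GAIN law on `A6P172635`, general `b`, every depth**: `v_p(Cas_j(b)) ≥ -6`, and `≥ -6` for `p ≤ d` (gen 10's `checkB` at `N = 6` and the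
row check at `R = -1`, `decide`d on both covers; gen 23's `DenomLaw.vgainPal_of_cover`). -/
theorem cas_geA6P172635 (hb : InPolytope b) (hs : Sorted7 b) (hbj : InPolytope (shift b j)) (hj1 : 1 ≤ j) (hj7 : j ≤ 7)
    (hprime : p.Prime) (hp5 : 5 ≤ p) (hwin : (b 0 + 2 : ℤ) < (p : ℤ) ^ 2) (hA : b 7 < (p : ℤ)) (hA6 : (p : ℤ) ≤ b 6) (hL17 : (p : ℤ) + b 1 + b 7 ≤ b 0) (hL26 : (p : ℤ) + b 2 + b 6 ≤ b 0) (hL35 : (p : ℤ) + b 3 + b 5 ≤ b 0) (hS16 : b 0 < (p : ℤ) + b 1 + b 6) (hS25 : b 0 < (p : ℤ) + b 2 + b 5) (hS34 : b 0 < (p : ℤ) + b 3 + b 4)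
    (hF1 : b 1 < 2 * (p : ℤ)) (hF2 : b 0 < 2 * (p : ℤ) + b 6 + b 7) (hcas : casoratian b j ≠ 0) :
    -6 + (if (p : ℤ) ≤ dOf b then (0 : ℤ) else 0) ≤ padicValRat p (casoratian b j) := by
  haveI : Fact p.Prime := ⟨hprime⟩
  have hp2 : p % 2 = 1 := Nat.odd_iff.1 (hprime.odd_of_ne_two (by omega))
  obtain ⟨h21, h32, h43, h54, h65, h76⟩ := sorted7_chain hs
  obtain ⟨h0, hb1, hb2, hb3, hb4, hb5, hb6, hb7, hc1⟩ := box hb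
  have hpb : (p : ℤ) ≤ b 0 := by linarith
  have hmin : min (-1 : ℤ) 0 = -1 := by norm_num
  rcases Int.emod_two_eq_zero_or_one (b 0) with hr | hr
  · have h := vgainPal_of_cover hb hj1 hj7 hbj hp5 hpb hwin (coverA6P172635_ev hb hs hA hA6 hL17 hL26 hL35 hS16 hS25 hS34 hF1 hF2 hp5 hp2 hr) (N := 6) (by norm_num) ⟨3, rfl⟩
      (by rw [oddFlag_false hr]; decide) (-1) (by norm_num) (by rw [oddFlag_false hr]; decide) hcas
    rw [hmin] at h; push_cast at h; split_ifs at h ⊢ <;> linarith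
  · have h := vgainPal_of_cover hb hj1 hj7 hbj hp5 hpb hwin (coverA6P172635_od hb hs hA hA6 hL17 hL26 hL35 hS16 hS25 hS34 hF1 hF2 hp5 hp2 hr) (N := 6) (by norm_num) ⟨3, rfl⟩
      (by rw [oddFlag_true hr]; decide) (-1) (by norm_num) (by rw [oddFlag_true hr]; decide) hcas
    rw [hmin] at h; push_cast at h; split_ifs at h ⊢ <;> linarith

/-- **`PathAccountingFirstPeriod`'s conclusion on `A6P172635`, EVERY sorted `b`, every direction `j`, depth `d < 2p`** (`N_p = 12`, `C⋆ ≤ 10`; node `-7` at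
`⌊d/p⌋ = 0`, `-6` at `⌊d/p⌋ = 1`). -/
theorem pathAccounting_profileA6P172635 (b : ℕ → ℤ) (j p : ℕ) (hb : InPolytope b) (hs : Sorted7 b) (hbj : InPolytope (shift b j))
    (hj1 : 1 ≤ j) (hj7 : j ≤ 7) (hprime : p.Prime) (hp5 : 5 ≤ p) (hwin : (b 0 + 2 : ℤ) < (p : ℤ) ^ 2) (hfp : FirstPeriod b p)
    (hA : b 7 < (p : ℤ)) (hA6 : (p : ℤ) ≤ b 6) (hL17 : (p : ℤ) + b 1 + b 7 ≤ b 0) (hL26 : (p : ℤ) + b 2 + b 6 ≤ b 0) (hL35 : (p : ℤ) + b 3 + b 5 ≤ b 0) (hS16 : b 0 < (p : ℤ) + b 1 + b 6) (hS25 : b 0 < (p : ℤ) + b 2 + b 5) (hS34 : b 0 < (p : ℤ) + b 3 + b 4) (hd2 : dOf b < 2 * (p : ℤ))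
    (hcas : casoratian b j ≠ 0) :
    dOf b / (p : ℤ) - pairFloors b p - min (if 2 ≤ dOf b / (p : ℤ) then (1 : ℤ) else 0) (5 - (cStar b p : ℤ))
      ≤ padicValRat p (casoratian b j) := by
  obtain ⟨hF1, hF2⟩ := fp_bounds hfp
  have hp0 : (0 : ℤ) < p := by exact_mod_cast hprime.pos
  have hpf : pairFloors b p = 12 := by
    obtain ⟨h21, h32, h43, h54, h65, h76⟩ := sorted7_chain hs
    exact pairFloors_eq_12e hb hs hprime.pos hS16 hS25 hS34 hL17 hL26 hL35 hfp
  rw [hpf]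
  have hC : (cStar b p : ℤ) ≤ 10 := by exact_mod_cast cStar_le_ten_A6P172634 hs hA hS16 hS25
  have hfd : dOf b / (p : ℤ) < 2 := by rw [Int.ediv_lt_iff_lt_mul hp0]; linarith
  rw [if_neg (by omega)]
  have hmin : -5 ≤ min (0 : ℤ) (5 - (cStar b p : ℤ)) := le_min (by norm_num) (by linarith)
  have hlaw := cas_geA6P172635 hb hs hbj hj1 hj7 hprime hp5 hwin hA hA6 hL17 hL26 hL35 hS16 hS25 hS34 hF1 hF2 hcas
  by_cases h1 : (p : ℤ) ≤ dOf b
  · have hfd1 : dOf b / (p : ℤ) ≤ 1 := by omega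
    rw [if_pos h1] at hlaw
    linarith
  · rw [if_neg h1] at hlaw
    push Not at h1
    have hd0 : 0 ≤ dOf b := by have := hb.2.2; unfold dOf; linarith
    have hfd0 : dOf b / (p : ℤ) = 0 := Int.ediv_eq_zero_of_lt hd0 h1
    rw [hfd0]
    linarith

/-- **THE NODE ON `A6P172635` AT DEPTH `d < 2p`, EVERY SORTED `b`: `PathAccountingFirstPeriod` with its binders VERBATIM plus `b_7 < p ≤ b_6`, the profile's
ORDER conditions and `d < 2p`.** -/
theorem pathAccountingFirstPeriod_profileA6P172635 :
    ∀ (b : ℕ → ℤ) (p : ℕ), InPolytope b → Sorted7 b → InPolytope (shift b 7) →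
      p.Prime → 5 ≤ p → (b 0 + 2 : ℤ) < (p : ℤ) ^ 2 → FirstPeriod b p →
      b 7 < (p : ℤ) → (p : ℤ) ≤ b 6 → (p : ℤ) + b 1 + b 7 ≤ b 0 → (p : ℤ) + b 2 + b 6 ≤ b 0 → (p : ℤ) + b 3 + b 5 ≤ b 0 → b 0 < (p : ℤ) + b 1 + b 6 → b 0 < (p : ℤ) + b 2 + b 5 → b 0 < (p : ℤ) + b 3 + b 4 → dOf b < 2 * (p : ℤ) → casoratian b 7 ≠ 0 →
        dOf b / (p : ℤ) - pairFloors b p - min (if 2 ≤ dOf b / (p : ℤ) then (1 : ℤ) else 0) (5 - (cStar b p : ℤ))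
          ≤ padicValRat p (casoratian b 7) :=
  fun b p hb hs hb7 hprime hp5 hwin hfp hA hA6 hL17 hL26 hL35 hS16 hS25 hS34 hd2 hcas =>
    pathAccounting_profileA6P172635 b 7 p hb hs hb7 (by norm_num) (by norm_num) hprime hp5 hwin hfp hA hA6 hL17 hL26 hL35 hS16 hS25 hS34 hd2 hcas

end A6P172635

/-! ## The a = 6 profile `A6P1635`: long pair blocks generated by [(1, 6), (3, 5)] (maximal short [(2, 5), (3, 4)]); `N_p = 13`, `C⋆ ≤ 10` -/

section A6P1635

variable {b : ℕ → ℤ} {j p : ℕ}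

/-- **`C⋆ ≤ 10` on `A6P1635`** (6 long parameters `b_7 < p ≤ b_6`; every pair block below one of the short pairs [(2, 5), (3, 4)] is short): the finite check over
the 5,040 orderings (`decide +kernel`). -/
theorem cStar_le_ten_A6P1635 {b : ℕ → ℤ} {p : ℕ} (hs : Sorted7 b) (hA : b 7 < (p : ℤ)) (hS25 : b 0 < (p : ℤ) + b 2 + b 5) (hS34 : b 0 < (p : ℤ) + b 3 + b 4) : cStar b p ≤ 10 := by
  obtain ⟨h21, h32, h43, h54, h65, h76⟩ := sorted7_chain hs
  refine DenomLaw.FirstPeriodKit.cStar_le_of_profile (fun i => i.val + 1 ≤ 6)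
    (fun i k => ¬ (((i.val + 1 ≤ 2 ∧ k.val + 1 ≤ 5) ∨ (k.val + 1 ≤ 2 ∧ i.val + 1 ≤ 5) ∨ (i.val + 1 ≤ 3 ∧ k.val + 1 ≤ 4) ∨ (k.val + 1 ≤ 3 ∧ i.val + 1 ≤ 4)) ∧ i.val ≠ k.val)) 10 ?_ ?_ (by decide +kernel)
  · intro i h
    have := i.isLt
    by_contra hc
    interval_cases hv : i.val <;> simp only [Nat.reduceAdd] at h hc <;> omega
  · intro i k hik h
    obtain ⟨hsh, hne⟩ := h
    have := i.isLt; have := k.isLt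
    exfalso
    rcases hsh with ⟨h1, h2⟩ | ⟨h1, h2⟩ | ⟨h1, h2⟩ | ⟨h1, h2⟩ <;> interval_cases hv : i.val <;> interval_cases hw : k.val <;> simp only [Nat.reduceAdd] at hik h1 h2 <;> omega

/-- **The V-GAIN law on `A6P1635`, general `b`, every depth**: `v_p(Cas_j(b)) ≥ -7`, and `≥ -7` for `p ≤ d` (gen 10's `checkB` at `N = 6` and the
row check at `R = -2`, `decide`d on both covers; gen 23's `DenomLaw.vgainPal_of_cover`). -/
theorem cas_geA6P1635 (hb : InPolytope b) (hs : Sorted7 b) (hbj : InPolytope (shift b j)) (hj1 : 1 ≤ j) (hj7 : j ≤ 7)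
    (hprime : p.Prime) (hp5 : 5 ≤ p) (hwin : (b 0 + 2 : ℤ) < (p : ℤ) ^ 2) (hA : b 7 < (p : ℤ)) (hA6 : (p : ℤ) ≤ b 6) (hL16 : (p : ℤ) + b 1 + b 6 ≤ b 0) (hL35 : (p : ℤ) + b 3 + b 5 ≤ b 0) (hS25 : b 0 < (p : ℤ) + b 2 + b 5) (hS34 : b 0 < (p : ℤ) + b 3 + b 4)
    (hF1 : b 1 < 2 * (p : ℤ)) (hF2 : b 0 < 2 * (p : ℤ) + b 6 + b 7) (hcas : casoratian b j ≠ 0) :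
    -7 + (if (p : ℤ) ≤ dOf b then (0 : ℤ) else 0) ≤ padicValRat p (casoratian b j) := by
  haveI : Fact p.Prime := ⟨hprime⟩
  have hp2 : p % 2 = 1 := Nat.odd_iff.1 (hprime.odd_of_ne_two (by omega))
  obtain ⟨h21, h32, h43, h54, h65, h76⟩ := sorted7_chain hs
  obtain ⟨h0, hb1, hb2, hb3, hb4, hb5, hb6, hb7, hc1⟩ := box hb
  have hpb : (p : ℤ) ≤ b 0 := by linarith
  have hmin : min (-2 : ℤ) 0 = -2 := by norm_num
  rcases Int.emod_two_eq_zero_or_one (b 0) with hr | hr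
  · have h := vgainPal_of_cover hb hj1 hj7 hbj hp5 hpb hwin (coverA6P1635_ev hb hs hA hA6 hL16 hL35 hS25 hS34 hF1 hF2 hp5 hp2 hr) (N := 6) (by norm_num) ⟨3, rfl⟩
      (by rw [oddFlag_false hr]; decide) (-2) (by norm_num) (by rw [oddFlag_false hr]; decide) hcas
    rw [hmin] at h; push_cast at h; split_ifs at h ⊢ <;> linarith
  · have h := vgainPal_of_cover hb hj1 hj7 hbj hp5 hpb hwin (coverA6P1635_od hb hs hA hA6 hL16 hL35 hS25 hS34 hF1 hF2 hp5 hp2 hr) (N := 6) (by norm_num) ⟨3, rfl⟩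
      (by rw [oddFlag_true hr]; decide) (-2) (by norm_num) (by rw [oddFlag_true hr]; decide) hcas
    rw [hmin] at h; push_cast at h; split_ifs at h ⊢ <;> linarith

/-- **`PathAccountingFirstPeriod`'s conclusion on `A6P1635`, EVERY sorted `b`, every direction `j`, depth `d < 2p`** (`N_p = 13`, `C⋆ ≤ 10`; node `-8` at
`⌊d/p⌋ = 0`, `-7` at `⌊d/p⌋ = 1`). -/
theorem pathAccounting_profileA6P1635 (b : ℕ → ℤ) (j p : ℕ) (hb : InPolytope b) (hs : Sorted7 b) (hbj : InPolytope (shift b j))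
    (hj1 : 1 ≤ j) (hj7 : j ≤ 7) (hprime : p.Prime) (hp5 : 5 ≤ p) (hwin : (b 0 + 2 : ℤ) < (p : ℤ) ^ 2) (hfp : FirstPeriod b p)
    (hA : b 7 < (p : ℤ)) (hA6 : (p : ℤ) ≤ b 6) (hL16 : (p : ℤ) + b 1 + b 6 ≤ b 0) (hL35 : (p : ℤ) + b 3 + b 5 ≤ b 0) (hS25 : b 0 < (p : ℤ) + b 2 + b 5) (hS34 : b 0 < (p : ℤ) + b 3 + b 4) (hd2 : dOf b < 2 * (p : ℤ))
    (hcas : casoratian b j ≠ 0) :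
    dOf b / (p : ℤ) - pairFloors b p - min (if 2 ≤ dOf b / (p : ℤ) then (1 : ℤ) else 0) (5 - (cStar b p : ℤ))
      ≤ padicValRat p (casoratian b j) := by
  obtain ⟨hF1, hF2⟩ := fp_bounds hfp
  have hp0 : (0 : ℤ) < p := by exact_mod_cast hprime.pos
  have hpf : pairFloors b p = 13 := by
    obtain ⟨h21, h32, h43, h54, h65, h76⟩ := sorted7_chain hs
    exact pairFloors_eq_13a hb hs hprime.pos hS25 hS34 hL16 hL35 hfp
  rw [hpf]
  have hC : (cStar b p : ℤ) ≤ 10 := by exact_mod_cast cStar_le_ten_A6P1635 hs hA hS25 hS34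
  have hfd : dOf b / (p : ℤ) < 2 := by rw [Int.ediv_lt_iff_lt_mul hp0]; linarith
  rw [if_neg (by omega)]
  have hmin : -5 ≤ min (0 : ℤ) (5 - (cStar b p : ℤ)) := le_min (by norm_num) (by linarith)
  have hlaw := cas_geA6P1635 hb hs hbj hj1 hj7 hprime hp5 hwin hA hA6 hL16 hL35 hS25 hS34 hF1 hF2 hcas
  by_cases h1 : (p : ℤ) ≤ dOf b
  · have hfd1 : dOf b / (p : ℤ) ≤ 1 := by omega
    rw [if_pos h1] at hlaw
    linarith
  · rw [if_neg h1] at hlaw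
    push Not at h1
    have hd0 : 0 ≤ dOf b := by have := hb.2.2; unfold dOf; linarith
    have hfd0 : dOf b / (p : ℤ) = 0 := Int.ediv_eq_zero_of_lt hd0 h1
    rw [hfd0]
    linarith

/-- **THE NODE ON `A6P1635` AT DEPTH `d < 2p`, EVERY SORTED `b`: `PathAccountingFirstPeriod` with its binders VERBATIM plus `b_7 < p ≤ b_6`, the profile's
ORDER conditions and `d < 2p`.** -/
theorem pathAccountingFirstPeriod_profileA6P1635 :
    ∀ (b : ℕ → ℤ) (p : ℕ), InPolytope b → Sorted7 b → InPolytope (shift b 7) →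
      p.Prime → 5 ≤ p → (b 0 + 2 : ℤ) < (p : ℤ) ^ 2 → FirstPeriod b p →
      b 7 < (p : ℤ) → (p : ℤ) ≤ b 6 → (p : ℤ) + b 1 + b 6 ≤ b 0 → (p : ℤ) + b 3 + b 5 ≤ b 0 → b 0 < (p : ℤ) + b 2 + b 5 → b 0 < (p : ℤ) + b 3 + b 4 → dOf b < 2 * (p : ℤ) → casoratian b 7 ≠ 0 →
        dOf b / (p : ℤ) - pairFloors b p - min (if 2 ≤ dOf b / (p : ℤ) then (1 : ℤ) else 0) (5 - (cStar b p : ℤ))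
          ≤ padicValRat p (casoratian b 7) :=
  fun b p hb hs hb7 hprime hp5 hwin hfp hA hA6 hL16 hL35 hS25 hS34 hd2 hcas =>
    pathAccounting_profileA6P1635 b 7 p hb hs hb7 (by norm_num) (by norm_num) hprime hp5 hwin hfp hA hA6 hL16 hL35 hS25 hS34 hd2 hcas

end A6P1635

end Summit.KontsevichZagierPeriods.Zeta5Search.FullProfile
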